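import Literature.AlgebraicGeometry.Frobenioids.EquivalenceGroupLikeType
import Literature.AlgebraicGeometry.Frobenioids.EquivalenceUnitsTransport
import Literature.AlgebraicGeometry.Frobenioids.BaseCategoryTheoreticity
import HarnessLib

/-!
# Frobenioids I, Theorem 3.4 (iii), group-like type: the automorphism `Ψ^{ℕ≥1}` and the assembly

Mochizuki, *The geometry of Frobenioids I: the general theory*, Kyushu J. Math. **62** (2008)
293–400, Thm. 3.4 (iii), kurims p. 62 ("there exists an automorphism of monoids
`Ψ^{ℕ≥1} : ℕ_{≥1} ⥲ ℕ_{≥1}` such that `Ψ` maps morphisms of Frobenius degree `d` to morphisms of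
Frobenius degree `Ψ^{ℕ≥1}(d)`") and proof p. 64 ll. 4–17 ("the assignment `p₁ ↦ p₂` determines a
homomorphism of monoids `Ψ^{ℕ≥1} : ℕ_{≥1} → ℕ_{≥1}` which [by considering a quasi-inverse to `Ψ`] is
easily seen to be an automorphism … since arbitrary morphisms may be written as composites of
prime-Frobenius morphisms and linear morphisms") [cite: MochizukiFrdI2008, Thm. 3.4 (iii) p.64].

PROOF-ONLY file (seat abc-iut-L1-t11; sub-DAG row `FrdI:Thm3.4(iii)/L01g GroupLikeTypeCase`, part
2/2, the "`Ψ_N` as a `MulEquiv ℕ+` (plumbing)" clause). For Frobenioids `C₁`, `C₂` of ISOTROPIC and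
GROUP-LIKE type and an equivalence `Ψ` with hypothesis (b) (`Ψ` and `Ψ⁻¹` preserve
base-isomorphisms):

* `FrdI.exists_degFr_map_eq_of_groupLikeType`: the Frobenius degree of `Ψ(f)`, `f` of Frobenius type,
  depends only on `deg_Fr(f)` (strong induction on the degree: split off a prime-Frobenius factor,
  Def. 1.3 (ii) / Prop. 1.10 (v), and use `exists_admissible_all_of_groupLikeType`);
* `FrdI.thm34iii_of_groupLikeType`: the morphism list of Thm. 3.4 (iii) AND an automorphism
  `ΨN : ℕ+ ≃* ℕ+` with `deg_Fr(Ψ φ) = ΨN(deg_Fr φ)` for EVERY arrow `φ` of `C₁` (factor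
  `φ = α ∘ β ∘ γ`, Def. 1.3 (iv)(a): `β` is an invertible pre-step, `α` and `Ψ(α)` are pull-back
  morphisms, hence linear), stated in the shape of the typed `PreFrobenioidData.Thm34iii` over
  `PreFrobenioidData.ofFunctor`, with hypothesis (b) in the typed form `PreFrobenioidData.HypB`; the
  clause "`Ψ^{ℕ≥1} = id` if `C₁`, `C₂` admit a non-group-like object" is vacuous here.

* `FrdI.exists_degreeAut_of_groupLikeType` (the `∃ ΨN` statement alone, hypotheses in `PreFrobenioid`
  form — the name and signature consumed by seat abc-iut-w4-d088's
  `EquivalenceGroupLikeQuasiIsotropic.lean`, whose own version of this file, landed minutes earlier under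
  the same path, was displaced by this one; this declaration restores its interface).

Together with seat abc-iut-L1-t13's `FrdI.thm34iii_morphisms_of_isOfFSMType` (the case with
non-group-like objects, bases of FSM-type) this covers both branches of hypothesis (b). No statement
of the paper is restated or strengthened.
-/

set_option backward.isDefEq.respectTransparency false

namespace Literature.AlgebraicGeometry.Frobenioids

open CategoryTheory Opposite

universe w v v' u u'

namespace FrdI

section Two

variable {D₁ : Type u} [Category.{v} D₁] {Φ₁ : D₁ᵒᵖ ⥤ CommMonCat.{w}} {C₁ : Type u'}
  [Category.{v'} C₁] {D₂ : Type u} [Category.{v} D₂] {Φ₂ : D₂ᵒᵖ ⥤ CommMonCat.{w}} {C₂ : Type u'}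
  [Category.{v'} C₂] {F₁ : C₁ ⥤ ElemFrobenioid Φ₁} {F₂ : C₂ ⥤ ElemFrobenioid Φ₂}

/-- **The Frobenius degree of `Ψ(f)`, `f` of Frobenius type, depends only on `deg_Fr(f)`**
(group-like type; strong induction on the degree, splitting off a prime-Frobenius factor).
[cite: MochizukiFrdI2008, Thm. 3.4 (iii) p.64] -/
theorem exists_degFr_map_eq_of_groupLikeType (hF₁ : PreFrobenioid.IsFrobenioid F₁)
    (hF₂ : PreFrobenioid.IsFrobenioid F₂) (hi₁ : ∀ A : C₁, PreFrobenioid.IsIsotropic F₁ A)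
    (hi₂ : ∀ A : C₂, PreFrobenioid.IsIsotropic F₂ A) (hg₁ : ∀ A : C₁, PreFrobenioid.IsGroupLikeObj F₁ A)
    (hg₂ : ∀ A : C₂, PreFrobenioid.IsGroupLikeObj F₂ A) (Ψ : C₁ ≌ C₂)
    (hB : ∀ ⦃A B : C₁⦄ (φ : A ⟶ B), PreFrobenioid.IsBaseIso F₁ φ →
      PreFrobenioid.IsBaseIso F₂ (Ψ.functor.map φ)) :
    ∀ n : ℕ, ∃ m : ℕ+, ∀ ⦃A A' : C₁⦄ (f : A ⟶ A'), PreFrobenioid.IsFrobeniusType F₁ f →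
      (PreFrobenioid.degFr F₁ f : ℕ) = n → PreFrobenioid.degFr F₂ (Ψ.functor.map f) = m := by
  intro n
  induction n using Nat.strong_induction_on with
  | _ n ih =>
    by_cases h0 : n = 0
    · exact ⟨1, fun A A' f _ hn => (PNat.ne_zero _ (hn.trans h0)).elim⟩
    by_cases h1 : n = 1
    · refine ⟨1, fun A A' f hf hn => ?_⟩
      have hd : PreFrobenioid.degFr F₁ f = 1 := PNat.eq (by rw [hn, h1]; rfl)
      haveI := PreFrobenioid.isIso_of_isFrobeniusType_of_degFr_eq_one hF₁ hf hd
      exact PreFrobenioid.isLinear_of_isIso F₂ _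
    · have hp : (Nat.minFac n).Prime := Nat.minFac_prime h1
      obtain ⟨k, hk⟩ := Nat.minFac_dvd n
      have hnpos : 0 < n := Nat.pos_of_ne_zero h0
      have hkpos : 0 < k := Nat.pos_of_ne_zero fun hk0 => by
        rw [hk0, mul_zero] at hk; exact hnpos.ne' hk
      have hklt : k < n := by rw [hk]; exact lt_mul_left hkpos hp.one_lt
      obtain ⟨mk, hmk⟩ := ih k hklt
      obtain ⟨p', -, hall⟩ := exists_admissible_all_of_groupLikeType hF₁ hF₂ hi₁ hi₂ hg₁ hg₂ Ψ hB
        ⟨Nat.minFac n, Nat.minFac_pos n⟩ hp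
      refine ⟨p' * mk, fun A A' f hf hn => ?_⟩
      obtain ⟨X, μ, ν, hμν, hμ, hμd, hν, hνd⟩ := PreFrobenioid.exists_split_of_isFrobeniusType hF₁ hf
        ⟨Nat.minFac n, Nat.minFac_pos n⟩ ⟨k, hkpos⟩ (PNat.eq (by rw [PNat.mul_coe, hn]; exact hk))
      rw [← hμν, Functor.map_comp, PreFrobenioid.degFr_comp, (hall A μ hμ hμd).2,
        hmk ν hν (by rw [hνd]; rfl)]

/-- `ℕ+`-indexed form of the previous statement. [cite: MochizukiFrdI2008, Thm. 3.4 (iii) p.64] -/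
theorem exists_degFr_map_eq_of_groupLikeType' (hF₁ : PreFrobenioid.IsFrobenioid F₁)
    (hF₂ : PreFrobenioid.IsFrobenioid F₂) (hi₁ : ∀ A : C₁, PreFrobenioid.IsIsotropic F₁ A)
    (hi₂ : ∀ A : C₂, PreFrobenioid.IsIsotropic F₂ A) (hg₁ : ∀ A : C₁, PreFrobenioid.IsGroupLikeObj F₁ A)
    (hg₂ : ∀ A : C₂, PreFrobenioid.IsGroupLikeObj F₂ A) (Ψ : C₁ ≌ C₂)
    (hB : ∀ ⦃A B : C₁⦄ (φ : A ⟶ B), PreFrobenioid.IsBaseIso F₁ φ →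
      PreFrobenioid.IsBaseIso F₂ (Ψ.functor.map φ)) (n : ℕ+) :
    ∃ m : ℕ+, ∀ ⦃A A' : C₁⦄ (f : A ⟶ A'), PreFrobenioid.IsFrobeniusType F₁ f →
      PreFrobenioid.degFr F₁ f = n → PreFrobenioid.degFr F₂ (Ψ.functor.map f) = m := by
  obtain ⟨m, hm⟩ := exists_degFr_map_eq_of_groupLikeType hF₁ hF₂ hi₁ hi₂ hg₁ hg₂ Ψ hB n
  exact ⟨m, fun A A' f hf hd => hm f hf (by rw [hd])⟩

/-- The degree of an arbitrary arrow is the degree of its Frobenius-type part (Def. 1.3 (iv)(a):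
pre-steps and pull-back morphisms are linear). [cite: MochizukiFrdI2008, Thm. 3.4 (iii) p.64] -/
theorem degFr_eq_degFr_frobeniusPart (hF₁ : PreFrobenioid.IsFrobenioid F₁) {A X Y B : C₁}
    {γ : A ⟶ X} {β : X ⟶ Y} {α : Y ⟶ B} (hβ : PreFrobenioid.IsPreStep F₁ β)
    (hα : PreFrobenioid.IsPullbackMorphism F₁ α) :
    PreFrobenioid.degFr F₁ (γ ≫ β ≫ α) = PreFrobenioid.degFr F₁ γ := by
  rw [PreFrobenioid.degFr_comp, PreFrobenioid.degFr_comp, show PreFrobenioid.degFr F₁ β = 1 from hβ.1,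
    show PreFrobenioid.degFr F₁ α = 1 from (hF₁.iv_b α hα).2, mul_one, mul_one]

/-- **The degree automorphism `Ψ^{ℕ≥1}` — isotropic and group-like type, `Ψ` and `Ψ⁻¹` preserving
base-isomorphisms**: an automorphism `ΨN : ℕ+ ≃* ℕ+` with `deg_Fr(Ψ φ) = ΨN(deg_Fr φ)` for EVERY
arrow `φ` of `C₁` ("the assignment `p₁ ↦ p₂` determines a homomorphism of monoids … which [by
considering a quasi-inverse to `Ψ`] is easily seen to be an automorphism", p. 64; arbitrary arrows
through the factorisation of Def. 1.3 (iv)(a)). (Name and signature as consumed by seat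
abc-iut-w4-d088's `EquivalenceGroupLikeQuasiIsotropic.lean`.) [cite: MochizukiFrdI2008, Thm. 3.4 (iii) p.64] -/
theorem exists_degreeAut_of_groupLikeType (hF₁ : PreFrobenioid.IsFrobenioid F₁)
    (hF₂ : PreFrobenioid.IsFrobenioid F₂) (hi₁ : ∀ A : C₁, PreFrobenioid.IsIsotropic F₁ A)
    (hi₂ : ∀ A : C₂, PreFrobenioid.IsIsotropic F₂ A) (hg₁ : ∀ A : C₁, PreFrobenioid.IsGroupLikeObj F₁ A)
    (hg₂ : ∀ A : C₂, PreFrobenioid.IsGroupLikeObj F₂ A) (Ψ : C₁ ≌ C₂)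
    (hB : ∀ ⦃A B : C₁⦄ (φ : A ⟶ B), PreFrobenioid.IsBaseIso F₁ φ →
      PreFrobenioid.IsBaseIso F₂ (Ψ.functor.map φ))
    (hB' : ∀ ⦃X Y : C₂⦄ (β : X ⟶ Y), PreFrobenioid.IsBaseIso F₂ β →
      PreFrobenioid.IsBaseIso F₁ (Ψ.inverse.map β)) :
    ∃ ΨN : ℕ+ ≃* ℕ+, ∀ ⦃A B : C₁⦄ (φ : A ⟶ B),
      PreFrobenioid.degFr F₂ (Ψ.functor.map φ) = ΨN (PreFrobenioid.degFr F₁ φ) := by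
  have hP₁ := hF₁.isPreFrobenioid
  have hP₂ := hF₂.isPreFrobenioid
  -- the two degree functions, for `Ψ` and for `Ψ⁻¹`
  choose g hg using exists_degFr_map_eq_of_groupLikeType' hF₁ hF₂ hi₁ hi₂ hg₁ hg₂ Ψ hB
  choose g' hg' using exists_degFr_map_eq_of_groupLikeType' hF₂ hF₁ hi₂ hi₁ hg₂ hg₁ Ψ.symm hB'
  obtain ⟨N₁⟩ := hP₁.isGraphConnected.nonempty
  obtain ⟨N₂⟩ := hP₂.isGraphConnected.nonempty
  -- multiplicativity of `g`
  have hmul : ∀ a b : ℕ+, g (a * b) = g a * g b := by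
    intro a b
    obtain ⟨X, fa, hfa, hfad⟩ := hF₁.ii_exists N₁ a
    obtain ⟨Y, fb, hfb, hfbd⟩ := hF₁.ii_exists X b
    have hab : PreFrobenioid.IsFrobeniusType F₁ (fa ≫ fb) := PreFrobenioid.IsFrobeniusType.comp F₁ hF₁ hfa hfb
    have habd : PreFrobenioid.degFr F₁ (fa ≫ fb) = a * b := by rw [PreFrobenioid.degFr_comp, hfad, hfbd]
    rw [← hg (a * b) (fa ≫ fb) hab habd, Functor.map_comp, PreFrobenioid.degFr_comp, hg a fa hfa hfad,
      hg b fb hfb hfbd]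
  -- `g' ∘ g = id` and `g ∘ g' = id` (a quasi-inverse, p. 64)
  have hleft : ∀ n : ℕ+, g' (g n) = n := by
    intro n
    obtain ⟨X, f, hf, hfd⟩ := hF₁.ii_exists N₁ n
    have hΨf : PreFrobenioid.IsFrobeniusType F₂ (Ψ.functor.map f) :=
      isFrobeniusType_map_of_groupLikeType hi₂ hg₂ Ψ hB hf
    have h1 := hg' (g n) (Ψ.functor.map f) hΨf (hg n f hf hfd)
    rw [show Ψ.symm.functor.map (Ψ.functor.map f) = Ψ.inverse.map (Ψ.functor.map f) from rfl,
      Ψ.inv_fun_map, PreFrobenioid.degFr_comp, PreFrobenioid.degFr_comp,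
      show PreFrobenioid.degFr F₁ (Ψ.unitInv.app N₁) = 1 from PreFrobenioid.isLinear_of_isIso F₁ _,
      show PreFrobenioid.degFr F₁ (Ψ.unit.app X) = 1 from PreFrobenioid.isLinear_of_isIso F₁ _,
      one_mul, mul_one, hfd] at h1
    exact h1.symm
  have hright : ∀ n : ℕ+, g (g' n) = n := by
    intro n
    obtain ⟨X, f, hf, hfd⟩ := hF₂.ii_exists N₂ n
    have hΨf : PreFrobenioid.IsFrobeniusType F₁ (Ψ.symm.functor.map f) :=
      isFrobeniusType_map_of_groupLikeType hi₁ hg₁ Ψ.symm hB' hf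
    have h1 := hg (g' n) (Ψ.symm.functor.map f) hΨf (hg' n f hf hfd)
    rw [show Ψ.functor.map (Ψ.symm.functor.map f) = Ψ.functor.map (Ψ.inverse.map f) from rfl,
      Ψ.fun_inv_map, PreFrobenioid.degFr_comp, PreFrobenioid.degFr_comp,
      show PreFrobenioid.degFr F₂ (Ψ.counit.app N₂) = 1 from PreFrobenioid.isLinear_of_isIso F₂ _,
      show PreFrobenioid.degFr F₂ (Ψ.counitInv.app X) = 1 from PreFrobenioid.isLinear_of_isIso F₂ _,
      one_mul, mul_one, hfd] at h1
    exact h1.symm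
  refine ⟨{ toFun := g, invFun := g', left_inv := hleft, right_inv := hright, map_mul' := hmul },
    fun A B φ => ?_⟩
  -- the degree formula for an arbitrary arrow, through its Frobenius-type part
  obtain ⟨X, Y, γ, β, α, hfac, hγ, hβ, hα⟩ := hF₁.iv_a_exists φ
  haveI : IsIso β := isIso_of_isPreStep_of_isGroupLikeObj hi₁ (hg₁ X) hβ
  have hΨα : PreFrobenioid.IsPullbackMorphism F₂ (Ψ.functor.map α) :=
    isPullbackMorphism_map_of_groupLikeType hF₁ hF₂ Ψ hB' hα
  show PreFrobenioid.degFr F₂ (Ψ.functor.map φ) = g (PreFrobenioid.degFr F₁ φ)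
  rw [← hfac, degFr_eq_degFr_frobeniusPart hF₁ hβ hα, Functor.map_comp, Functor.map_comp,
    PreFrobenioid.degFr_comp, PreFrobenioid.degFr_comp,
    show PreFrobenioid.degFr F₂ (Ψ.functor.map β) = 1 from PreFrobenioid.isLinear_of_isIso F₂ _,
    show PreFrobenioid.degFr F₂ (Ψ.functor.map α) = 1 from (hF₂.iv_b _ hΨα).2, mul_one, mul_one]
  exact hg _ γ hγ rfl

/-- **Thm. 3.4 (iii) for Frobenioids of isotropic and GROUP-LIKE type** (hypothesis (b) in the
typed form `PreFrobenioidData.HypB`): the morphism list of (iii), and an automorphism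
`Ψ^{ℕ≥1} : ℕ+ ≃* ℕ+` with `deg_Fr(Ψ φ) = Ψ^{ℕ≥1}(deg_Fr φ)` for every arrow `φ`; the last clause
of the typed statement ("`Ψ^{ℕ≥1} = id` if `C₁`, `C₂` admit a non-group-like object") is vacuous in
group-like type. Stated in the shape of `PreFrobenioidData.Thm34iii`'s conclusion over
`PreFrobenioidData.ofFunctor`. [cite: MochizukiFrdI2008, Thm. 3.4 (iii) p.62] -/
theorem thm34iii_of_groupLikeType (hF₁ : PreFrobenioid.IsFrobenioid F₁)
    (hF₂ : PreFrobenioid.IsFrobenioid F₂) (hi₁ : ∀ A : C₁, PreFrobenioid.IsIsotropic F₁ A)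
    (hi₂ : ∀ A : C₂, PreFrobenioid.IsIsotropic F₂ A)
    (hgt₁ : (PreFrobenioidData.ofFunctor Φ₁ F₁).IsOfGroupLikeType)
    (hgt₂ : (PreFrobenioidData.ofFunctor Φ₂ F₂).IsOfGroupLikeType) (Ψ : C₁ ≌ C₂)
    (hHypB : (PreFrobenioidData.ofFunctor Φ₁ F₁).HypB (PreFrobenioidData.ofFunctor Φ₂ F₂) Ψ) :
    (PreFrobenioidData.PreservesMor Ψ.functor (PreFrobenioidData.ofFunctor Φ₁ F₁).IsFrobeniusType
        (PreFrobenioidData.ofFunctor Φ₂ F₂).IsFrobeniusType ∧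
      PreFrobenioidData.PreservesMor Ψ.functor (PreFrobenioidData.ofFunctor Φ₁ F₁).IsLinear
        (PreFrobenioidData.ofFunctor Φ₂ F₂).IsLinear ∧
      PreFrobenioidData.PreservesMor Ψ.functor (PreFrobenioidData.ofFunctor Φ₁ F₁).IsBaseIso
        (PreFrobenioidData.ofFunctor Φ₂ F₂).IsBaseIso ∧
      PreFrobenioidData.PreservesMor Ψ.functor (PreFrobenioidData.ofFunctor Φ₁ F₁).IsCoAngular
        (PreFrobenioidData.ofFunctor Φ₂ F₂).IsCoAngular ∧
      PreFrobenioidData.PreservesMor Ψ.functor (PreFrobenioidData.ofFunctor Φ₁ F₁).IsPullbackMorphism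
        (PreFrobenioidData.ofFunctor Φ₂ F₂).IsPullbackMorphism ∧
      PreFrobenioidData.PreservesMor Ψ.functor (PreFrobenioidData.ofFunctor Φ₁ F₁).IsIsometry
        (PreFrobenioidData.ofFunctor Φ₂ F₂).IsIsometry ∧
      PreFrobenioidData.PreservesMor Ψ.functor (PreFrobenioidData.ofFunctor Φ₁ F₁).IsLBInvertible
        (PreFrobenioidData.ofFunctor Φ₂ F₂).IsLBInvertible) ∧
    ∃ ΨN : ℕ+ ≃* ℕ+, (∀ ⦃A B : C₁⦄ (φ : A ⟶ B),
        (PreFrobenioidData.ofFunctor Φ₂ F₂).degFr (Ψ.functor.map φ) =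
          ΨN ((PreFrobenioidData.ofFunctor Φ₁ F₁).degFr φ)) ∧
      ((∃ A : C₁, ¬ (PreFrobenioidData.ofFunctor Φ₁ F₁).IsGroupLikeObj A) →
        (∃ A : C₂, ¬ (PreFrobenioidData.ofFunctor Φ₂ F₂).IsGroupLikeObj A) → ΨN = MulEquiv.refl ℕ+) := by
  have hg₁ : ∀ A : C₁, PreFrobenioid.IsGroupLikeObj F₁ A := fun A =>
    (PreFrobenioidData.ofFunctor_isGroupLikeObj F₁ A).1 (hgt₁.obj A)
  have hg₂ : ∀ A : C₂, PreFrobenioid.IsGroupLikeObj F₂ A := fun A =>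
    (PreFrobenioidData.ofFunctor_isGroupLikeObj F₂ A).1 (hgt₂.obj A)
  obtain ⟨hBf, hBi⟩ := hHypB hgt₁ hgt₂
  have hB : ∀ ⦃A B : C₁⦄ (φ : A ⟶ B), PreFrobenioid.IsBaseIso F₁ φ →
      PreFrobenioid.IsBaseIso F₂ (Ψ.functor.map φ) := fun A B φ hφ => hBf φ hφ
  have hB' : ∀ ⦃X Y : C₂⦄ (β : X ⟶ Y), PreFrobenioid.IsBaseIso F₂ β →
      PreFrobenioid.IsBaseIso F₁ (Ψ.inverse.map β) := fun X Y β hβ => hBi β hβ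
  obtain ⟨ΨN, hΨN⟩ := exists_degreeAut_of_groupLikeType hF₁ hF₂ hi₁ hi₂ hg₁ hg₂ Ψ hB hB'
  refine ⟨⟨fun A B φ hφ => ?_, fun A B φ hφ => ?_, fun A B φ hφ => ?_, fun A B φ _ => ?_,
    fun A B φ hφ => ?_, fun A B φ _ => ?_, fun A B φ _ => ?_⟩, ΨN, fun A B φ => hΨN φ,
    fun ⟨A, hA⟩ _ => (hA (hgt₁.obj A)).elim⟩
  · rw [PreFrobenioidData.ofFunctor_isFrobeniusType] at hφ ⊢
    exact isFrobeniusType_map_of_groupLikeType hi₂ hg₂ Ψ hB hφ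
  · exact isLinear_map_of_groupLikeType hF₁ hF₂ hi₁ hg₁ Ψ hB' hφ
  · exact hB φ hφ
  · rw [PreFrobenioidData.ofFunctor_isCoAngular]
    exact isCoAngular_map_of_isotropicType hi₂ Ψ φ
  · rw [PreFrobenioidData.ofFunctor_isPullbackMorphism] at hφ ⊢
    exact isPullbackMorphism_map_of_groupLikeType hF₁ hF₂ Ψ hB' hφ
  · exact isIsometry_map_of_groupLikeType hg₂ Ψ φ
  · rw [PreFrobenioidData.ofFunctor_isLBInvertible]
    exact isLBInvertible_map_of_groupLikeType hi₂ hg₂ Ψ φ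

end Two

end FrdI

end Literature.AlgebraicGeometry.Frobenioids
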